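import Literature.MathematicalPhysics.QuantumFieldTheory.Balaban1983to89.B9Eq3105OfLocalInverse
import Literature.MathematicalPhysics.QuantumFieldTheory.Balaban1983to89.Node00.OpsYOps312OfRecordPar
import Literature.MathematicalPhysics.QuantumFieldTheory.Balaban1983to89.B9WalkLettersBondLeib

/-!
# `Balaban1983to89.B9Eq3105OfLocalInverseQ` — T. Bałaban, *Propagators for lattice gauge theories in a background field*, Commun. Math. Phys. **99** (1985)
# 389–434 [Balaban1985BackgroundPropagators], (3.104) p. 414 «Δ_a hA = hΔ_a A − K(h)A − P₁(∂h)A» AND (3.105) p. 414 «Δ_aG₀ = I − R» (with its transpose, and with the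
# local-inverse laws holding up to a displayed defect) RE-PRESSED ONCE OVER A GENERIC AVERAGING PAIR `(𝔮, 𝔮⋆)` — i.e. at node00-def-Y's `OpsYSectDQ.deltaAQY i 𝔮 𝔮s parS G′`
# ((3.26) with `𝔮⋆ a 𝔮` in place of `Q*aQ`) — so that lit-balaban M5.7's (3.104)∕(3.105) chain (`B9Eq3104CutoffCommutators` §4, `B9Eq3105OfLocalInverse`), typed at the
# straight-contour pair `deltaAY parS parB G′ = deltaAQY (QY parB) (QsY parB) parS G′` (`deltaAQY_QY`, `rfl`), becomes available at PRINT's knit pair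
# `(qKnitOfRecord, qsKnitOfRecord) = (QknitY, QknitY†)` of (3.115) p. 418 (dag-n06-l `B9Eq3115KnitLetterY`), which agrees with `QY parB` only at `U = 1` (`QknitY_one`).

statement-level skeleton of published theorems with citation tags; proofs where landed; nothing here is a claim about the Yang–Mills mass gap

CITATION HEADER (lean-in-tree rule).  B9 = [Balaban1985BackgroundPropagators] (PDF held: `paper:balaban1985-cmp99-background-propagators`, journal page = PDF page + 388).
p. 414 (3.104): «Δ_a hA = hΔ_a − K(h)A − P₁(∂h)A, where K(h) is a sum of a first order differential operator and the last two terms on the right-hand side of (3.103)»;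
(3.103): «(Q*aQhA)(b) = h(b₋)(Q*aQA)(b) − (S*(∂h)aQA)(b) + (Q*aS(∂h)A)(b)»; (3.101): «(DPD*hA)_μ(x) = h(x)(DPD*A)_μ(x) + (P₁(∂h)A)_μ(x)»; p. 414 «DRD* = DD* − DPD*»;
(3.105): «Δ_aG₀ = I − Σ_□K(h_□)G_□h_□ − Σ_□(1 − ζ_□̃)DPD*h_□G_□h_□ − Σ_□ζ_□̃(DPD* − DP_□D*)h_□G_□h_□ − Σ_□ζ_□̃P_{□,1}(∂h_□)G_□h_□ = I − R»; (3.87) p. 409 «G₀ = Σ_{□∈𝒟} h_□G_□h_□»;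
p. 408 «Σ_□ h_□² = 1»; (3.26)–(3.27) p. 395 «Δ_a = Δ + DRD* + Q*aQ», «G(U) = Δ_a(U)⁻¹»; (3.115) p. 418 «Q_jDλ = D̄ʲQ′_jλ» (print's `Q_j(U)` = the linear part of the composite
modified average, (3.13) p. 392, (3.14)–(3.15) p. 393).  Page images of pp. 413–414 confirmed by the lit-balaban desk (service line 2026-08-31T12:17:29Z: «print has Q_j(c, d) in the middle
member of (3.102) — sic, = Q_j(c, b)»; «hΔ_a without the A in (3.104) — sic»).  [4] = [Balaban1984PropagatorsII] (2.52) p. 232 («A summation preserves it also»).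

WHY THIS FILE (cell context).  The N06 certificate heads of record «KESC-A» ∕ «KE₉X-A» (dag-n06-d, W-b) carry the bond-sector walk letters of Theorem 3.10 at the record
`GA = GAQY i (qKnitOfRecord …) (qsKnitOfRecord …) (parKnitY i) (GpY i (parKnitY i))` — def-Y's (3.27) over PRINT's knit averaging — and DISPLAY the four `U`-laws `hlawsA`
(two inverse laws + (3.105) + (3.105)ᵀ) about GENERIC factor families `RfA ∕ RtA`.  dag-n06-d's `W-b-3105-MEMO.md` (2026-08-31): pinning those families to print's
(3.105) families is blocked because «lit M5.7's entire (3.104)∕(3.105) chain is typed at `deltaAY parS parB Gp = deltaAQY (QY parB) (QsY parB) …`, the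
PARALLEL-TRANSPORT averaging `QY parB`, which equals print's knit `Q` only at `U = 1`; no (3.101)∕(3.104) identity for `QknitY` exists».  The lit-balaban desk
(2026-08-31T12:17Z) located the split: the ALGEBRA half of (3.101)–(3.105) is letter-generic (the commutator `K(h)` is DEFINED as `h·Δ_loc − Δ_loc·h`, exactly as in
M5.7's `KhBY`; (3.103) is the Leibniz rule through the intermediate carrier with `[a, h] = 0`); only the KERNEL of `[𝔮, h]` at `𝔮 = QknitY` (print's `S_j(∂h)`) and
its SIZE `O(M⁻¹)` are letter-specific (they feed the factor bounds `hfacA`, not the identities).  THIS FILE is that algebra half, once, for every pair `(𝔮, 𝔮⋆)`: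
every proof is M5.7's with `QY ∕ QsY ↦ 𝔮 ∕ 𝔮⋆`, and §4 adds the image through dag-n06-d's algebra morphism `B9WalkLettersBondLeib.coordAlgHomB` in the LITERAL
currency of the heads' `hlawsA`.3∕.4 (`S0coKq ∕ GcoK ∕ mulOp`), so that dag-n06-d's pin edition of `RfA ∕ RtA` (their door (b2)) is a substitution.

WHAT IS DEFINED AND PROVED (sorry-free; two definitions WITH BODIES (`deltaLocQY`, `KhBQY`) + theorems; no `def … : Prop`, no new named fact, no estimate).
* §1 `deltaLocQY i 𝔮 𝔮s U := Δ(U) + D_UD*_U + 𝔮⋆(U) a 𝔮(U)` (the local part of `Δ_a[𝔮]`); ★ `deltaAQY_eq_loc_sub` (`Δ_a[𝔮] = Δ_loc[𝔮] − DPD*`, «DRD* = DD* − DPD*»);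
  `KhBQY i h 𝔮 𝔮s U := [h]Δ_loc[𝔮](U)` (print's `K(h)` at the pair); `deltaLocQY_mul_cutMulY`; ★★ `deltaAQY_comp_cutMulY` ∕ `deltaAQY_mul_cutMulY` — **(3.104) at the generic
  pair**; `cutCommR_qs_aY_q` — **(3.103) at the generic pair** (`[h](𝔮⋆a𝔮) = ([h]𝔮⋆)a𝔮 + 𝔮⋆a([h]𝔮)` for ANY intermediate profile on index bonds); ★ `KhBQY_eq_sum` (K(h) = Hessian
  part + `DD*` part + the two (3.103) terms, intermediate profile `hIbY` = print's `h(c₋)`); ★ `deltaAQY_comp_sum` (the (3.105)-type sum, algebraic core); `rfl` faces at the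
  straight pair: `deltaLocQY_QY = deltaLocY`, `KhBQY_QY = KhBY`.
* §2 ★ `eq3105_deltaAQY_defect` ∕ ★ `eq3105T_deltaAQY_defect` — **(3.105) and its transpose at `Δ_a[𝔮](U)` WITH A DEFECT FAMILY** for ANY partition family `Σ hf² = 1`, ANY
  cut-offs `ζ = 1 on supp hf`, ANY cube letters `Gl`, local projections `Pl` with (3.101) commutators `P1l`, defects `E` (lit's ring-generic `eq3105_sum_defect` ∕
  `eq3105T_sum_defect` by name); `eq3105Q_hT_defect` ∕ `eq3105QT_hT_defect` (partition of record `hTY`); `eq3105Q_hT_ofLocalInverse` ∕ `eq3105QT_hT_ofLocalInverse` (exact laws: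
  the four printed families only).
* §3 `eq3105Q_restrict_defect` ∕ `eq3105QT_restrict_defect` (`End_ℂ → End_ℝ`); `eq3105Q_conj_defect` ∕ `eq3105QT_conj_defect` (lit's real coordinates `conj b`: the `h388 ∕ h388T`
  shapes of the `B9Thm310GTorusRegular*` summation engines, now at the generic pair).
* §4 ★★ `eq3105Q_coordsB_defect` ∕ ★★ `eq3105QT_coordsB_defect` — the same identities pushed through `coordAlgHomB` and spelled in the record's letters:
  `S0coKq i b B cfg 𝔮 𝔮s parS G′ U₁ * (Σ_□ mulOp h_□ * GcoK i b B cfg (Gl □) U₁ * mulOp h_□) = 1 − Σ (four families) − Σ_□ coordAlgHomB (E □)` (and the transpose), the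
  scalings `c_R(b)⁻¹ · c_R(b)` cancelling under `c_R(b) ≠ 0`; `mulOp h_□` = the heads' `mulOp (hWalkBY x □)` on the nose.
HONEST SCOPE.  Finite-dimensional operator algebra over landed letters (identities only; [folklore] bookkeeping around the printed (3.101)–(3.105)); NO estimate: the sizes
`O(M⁻¹)` of `[𝔮, h]` at `𝔮 = QknitY` (print's `S_j(∂h)`, p. 414; the lit-balaban desk's item (i)+(ii)) and the smallness of families 2–4 (pp. 414–415; cell GAPS
G-B9-05∕06a∕07) are NOT touched; the defect families are (R)-design terms of `B9Eq3105OfLocalInverse` (= 0 for print's letters); nothing of Theorem 3.10 ∕ 3.3 asserted;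
no Node00 letter is modified (`deltaAQY`, `S0coKq`, `GcoK`, `coordAlgHomB` consumed by name).  COUNT-NEUTRAL (`--supports stmt-QuantumFields-27364`); N06 NOT discharged;
K1⁹ NOT closed.  One finite lattice at a time — nothing continuum ∕ ℝ⁴ ∕ OS ∕ mass gap ∕ Clay; the Yang–Mills mass gap is NOT proved here.  NEW file; nothing landed is
modified.  No `sorry`, no `axiom`, no `instance`, no `notation`.  Net new unproved facts: 0.  Cell `pub-ymgap` (HUMAN RULING D-0062), node N06 [B9], seat
`pub-ymgap-dag-n06-j` (g39; bundle F5 supplier lane), 2026-08-31.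
RELATED, NOT DUPLICATED (searched 2026-08-31: `rg 'deltaLocQY|KhBQY|deltaAQY_comp_cutMulY|eq3105_deltaAQY|deltaAQY_eq_loc_sub|eq3105Q'` over `Literature ∕ Summits` = ∅):
`B9Eq3104CutoffCommutators` §4 and `B9Eq3105OfLocalInverse` (the straight pair — recovered here by the `_QY` faces), `B9Eq3105Sum` (any ring), `Node00.OpsYSectDQ ∕
OpsYSectDCoordsQ ∕ OpsYOps312OfRecordPar` (the `𝔮`-generic Sect.-D letters and coordinate models), `B9WalkLettersBondLeib` (the algebra morphism and the cut-off dictionary).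
-/

noncomputable section

namespace Literature.MathematicalPhysics.QuantumFieldTheory.Balaban1983to89.B9Eq3105OfLocalInverseQ

open Node00
open B9Thm37Sum (mulOp)
open B9Thm37CubeCoverCommutators (cutMulY cutMulY_apply hTY hTY_apply sum_hTY_sq sum_cutMulY_mul_self)
open B9Eq3104CutoffCommutators (cutCommR cutCommR_add cutCommR_comp cutCommR_aY cutCommR_gradY_divY cutCommR_coCurl_jordan_curl comp_cutMulY_eq_sub
  hBdY hBdY_apply hPlY hIbY deltaLocY DPDsY KhBY P1Y DPDsY_comp_cutMulY)
open B9Eq3105AtLetters (cutMulY_mul_cutMulY_of_eq_one)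
open B9Eq3105TAtLetters (cutMulY_mul_cutMulY_of_eq_one')
open B9Eq3105OfLocalInverse (eq3105_sum_defect eq3105T_sum_defect)
open B9Eq352DivFormLetters (conj conj_sub conj_neg)
open B9Eq352GradLetters (conj_add)
open B9Thm37GpTorusRegular (conj_one conj_sum)
open B9Thm39CinvTorusRegular (conj_cutMulY)
open B9Thm39ReadingCoords (cR39)
open B9CoReadingCoords (XBK GcoK coordOpK)
open B9WalkLettersBondLeib (coordAlgHomB coordAlgHomB_apply mulOp_bond_eq_coordOpK)
open B6KLevelCensusIndexV1 (KIdx)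
open B6Cover236MultiLevelBlocks (cubes)
open Node00.OpsYNablaBridge (chartY)
open Literature.MathematicalPhysics.QuantumFieldTheory.Balaban1983to89.Node00.OpsYQLetter (QLetterY QsLetterY)
open Literature.MathematicalPhysics.QuantumFieldTheory.Balaban1983to89.Node00.OpsYOps312OfRecordPar (S0coKq)
open scoped Matrix

variable {d ℓ : ℕ} {hd : 1 ≤ d + 1} {hL : Odd (ℓ + 1) ∧ 1 < ℓ + 1} {b₀ b₁ : ℝ}
variable {𝔸 : Type} [NormedRing 𝔸] [NormedAlgebra ℂ 𝔸] [CompleteSpace 𝔸]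
variable (i : KIdx d ℓ hd hL b₀ b₁)

/-! ## §1 `Δ_loc[𝔮]`, `K[𝔮](h)`, (3.103)∕(3.104) at the generic pair, and the (3.105)-type sum -/

section Kh

/-- **THE LOCAL PART OF `Δ_a[𝔮](U)`**: `Δ_loc[𝔮](U) := Δ(U) + D_U D*_U + 𝔮⋆(U) a 𝔮(U)` («DRD* = DD* − DPD*»; M5.7's `deltaLocY` with `Q*aQ ↦ 𝔮⋆a𝔮`).
[cite: Balaban1985BackgroundPropagators, (3.26) p.395, p.414, (3.115) p.418] -/
def deltaLocQY (𝔮 : QLetterY 𝔸 i) (𝔮s : QsLetterY 𝔸 i) (U : CfgY 𝔸 i) : (FBondY i → 𝔸) →ₗ[ℂ] (FBondY i → 𝔸) :=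
  hessY i U + gradY i U ∘ₗ divY i U + 𝔮s U ∘ₗ aY i ∘ₗ 𝔮 U

/-- ★ `Δ_a[𝔮](U) = Δ_loc[𝔮](U) − D_U P(U) D*_U` («DRD* = DD* − DPD*», `P = 1 − R`). [cite: Balaban1985BackgroundPropagators, (3.26) p.395, p.414] -/
theorem deltaAQY_eq_loc_sub (𝔮 : QLetterY 𝔸 i) (𝔮s : QsLetterY 𝔸 i) (parS : SiteParY 𝔸 i) (Gp : SiteOpY 𝔸 i) (U : CfgY 𝔸 i) :
    deltaAQY i 𝔮 𝔮s parS Gp U = deltaLocQY i 𝔮 𝔮s U - DPDsY i parS Gp U := by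
  simp only [deltaAQY, deltaLocQY, DPDsY, LinearMap.comp_sub, LinearMap.sub_comp, LinearMap.id_comp]
  abel

/-- the straight-contour face: at def-Y's pair `(QY parB, QsY parB)` the local part IS M5.7's `deltaLocY` (definitionally).
[cite: Balaban1985BackgroundPropagators, (3.26) p.395, bookkeeping] -/
theorem deltaLocQY_QY (parB : BondParY 𝔸 i) : deltaLocQY i (QY i parB) (QsY i parB) = deltaLocY i parB := rfl

/-- ★ **`K[𝔮](h)(U)` OF (3.104) AT THE GENERIC PAIR**: the cut-off commutator of the local part, `K(h) := h·Δ_loc[𝔮] − Δ_loc[𝔮]·h` («a sum of a first order differential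
operator and the last two terms on the right-hand side of (3.103)»). [cite: Balaban1985BackgroundPropagators, (3.104) p.414] -/
def KhBQY (h : SiteY i → ℝ) (𝔮 : QLetterY 𝔸 i) (𝔮s : QsLetterY 𝔸 i) (U : CfgY 𝔸 i) : (FBondY i → 𝔸) →ₗ[ℂ] (FBondY i → 𝔸) :=
  cutCommR (hBdY i h) (hBdY i h) (deltaLocQY i 𝔮 𝔮s U)

/-- the straight-contour face: `K[QY parB](h) = KhBY h parB` (definitionally). [cite: Balaban1985BackgroundPropagators, (3.104) p.414, bookkeeping] -/
theorem KhBQY_QY (h : SiteY i → ℝ) (parB : BondParY 𝔸 i) : KhBQY i h (QY i parB) (QsY i parB) = KhBY i h parB := rfl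

/-- (3.104), P-free part, at the generic pair: `Δ_loc[𝔮](U)·(h·) = (h·)·Δ_loc[𝔮](U) − K[𝔮](h)(U)`. [cite: Balaban1985BackgroundPropagators, (3.104) p.414] -/
theorem deltaLocQY_mul_cutMulY (h : SiteY i → ℝ) (𝔮 : QLetterY 𝔸 i) (𝔮s : QsLetterY 𝔸 i) (U : CfgY 𝔸 i) :
    deltaLocQY i 𝔮 𝔮s U * cutMulY (hBdY i h) = cutMulY (hBdY i h) * deltaLocQY i 𝔮 𝔮s U - KhBQY i h 𝔮 𝔮s U :=
  comp_cutMulY_eq_sub (hBdY i h) (hBdY i h) (deltaLocQY i 𝔮 𝔮s U)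

/-- ★★ **(3.104) AT THE GENERIC PAIR**: `Δ_a[𝔮](U) ∘ (h·) = (h·) ∘ Δ_a[𝔮](U) − K[𝔮](h)(U) − P₁(∂h)(U)` («Δ_a hA = hΔ_a A − K(h)A − P₁(∂h)A»; `P₁(∂h) = [DPD*, h]` is pair-free,
M5.7's `P1Y`). [cite: Balaban1985BackgroundPropagators, (3.104) p.414, (3.101) p.414] -/
theorem deltaAQY_comp_cutMulY (h : SiteY i → ℝ) (𝔮 : QLetterY 𝔸 i) (𝔮s : QsLetterY 𝔸 i) (parS : SiteParY 𝔸 i) (Gp : SiteOpY 𝔸 i) (U : CfgY 𝔸 i) :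
    deltaAQY i 𝔮 𝔮s parS Gp U ∘ₗ cutMulY (hBdY i h)
      = cutMulY (hBdY i h) ∘ₗ deltaAQY i 𝔮 𝔮s parS Gp U - KhBQY i h 𝔮 𝔮s U - P1Y i h parS Gp U := by
  rw [deltaAQY_eq_loc_sub, LinearMap.sub_comp, comp_cutMulY_eq_sub (hBdY i h) (hBdY i h) (deltaLocQY i 𝔮 𝔮s U), DPDsY_comp_cutMulY,
    KhBQY, LinearMap.comp_sub]
  abel

/-- (3.104) at the generic pair in `Module.End` product notation. [cite: Balaban1985BackgroundPropagators, (3.104) p.414] -/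
theorem deltaAQY_mul_cutMulY (h : SiteY i → ℝ) (𝔮 : QLetterY 𝔸 i) (𝔮s : QsLetterY 𝔸 i) (parS : SiteParY 𝔸 i) (Gp : SiteOpY 𝔸 i) (U : CfgY 𝔸 i) :
    deltaAQY i 𝔮 𝔮s parS Gp U * cutMulY (hBdY i h)
      = cutMulY (hBdY i h) * deltaAQY i 𝔮 𝔮s parS Gp U - KhBQY i h 𝔮 𝔮s U - P1Y i h parS Gp U :=
  deltaAQY_comp_cutMulY i h 𝔮 𝔮s parS Gp U

omit [CompleteSpace 𝔸] in
/-- ★ **(3.103) AT THE GENERIC PAIR**: `[h](𝔮⋆a𝔮) = ([h]𝔮⋆)∘a∘𝔮 + 𝔮⋆∘a∘([h]𝔮)` for ANY intermediate profile `hI` on index bonds («(Q*aQhA)(b) = h(b₋)(Q*aQA)(b) −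
(S*(∂h)aQA)(b) + (Q*aS(∂h)A)(b)» — two terms: the weight `a` acts by LEVEL CONSTANTS (`a(L^jη)^{d−2}` on `Λ_j`, (3.16) p. 393; the `a_j` of (3.24) p. 394), so it
commutes with every cut-off on index bonds — immediate, M5.7's `cutCommR_aY`). [cite: Balaban1985BackgroundPropagators, (3.103) p.414, (3.16) p.393, (3.24) p.394] -/
theorem cutCommR_qs_aY_q (hB : FBondY i → ℝ) (hI : IBondY i → ℝ) (q : (FBondY i → 𝔸) →ₗ[ℂ] (IBondY i → 𝔸))
    (qs : (IBondY i → 𝔸) →ₗ[ℂ] (FBondY i → 𝔸)) :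
    cutCommR hB hB (qs ∘ₗ aY i ∘ₗ q) = cutCommR hB hI qs ∘ₗ aY i ∘ₗ q + qs ∘ₗ aY i ∘ₗ cutCommR hI hB q := by
  rw [cutCommR_comp hB hI hB, cutCommR_comp hI hI hB, cutCommR_aY, LinearMap.zero_comp, zero_add]

/-- ★ **`K[𝔮](h)` DECOMPOSED as print lists it**: the Hessian part `[h](D*𝒦D) + [h]Δ′₂`, the `DD*` part `([h]D)D* + D([h]D*)`, and the two (3.103) terms
`([h]𝔮⋆)a𝔮 + 𝔮⋆a([h]𝔮)` with the index-bond profile `hIbY h` (print's `h(c₋)`). [cite: Balaban1985BackgroundPropagators, (3.104) p.414, (3.103) p.414, (3.10) p.392] -/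
theorem KhBQY_eq_sum (h : SiteY i → ℝ) (𝔮 : QLetterY 𝔸 i) (𝔮s : QsLetterY 𝔸 i) (U : CfgY 𝔸 i) :
    KhBQY i h 𝔮 𝔮s U
      = (cutCommR (hBdY i h) (hPlY i h) (coCurlY i U) ∘ₗ jordanY i U ∘ₗ curlY i U
          + coCurlY i U ∘ₗ jordanY i U ∘ₗ cutCommR (hPlY i h) (hBdY i h) (curlY i U)
          + cutCommR (hBdY i h) (hBdY i h) (curv2Y i U))
        + (cutCommR (hBdY i h) h (gradY i U) ∘ₗ divY i U + gradY i U ∘ₗ cutCommR h (hBdY i h) (divY i U))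
        + (cutCommR (hBdY i h) (hIbY i h) (𝔮s U) ∘ₗ aY i ∘ₗ 𝔮 U
          + 𝔮s U ∘ₗ aY i ∘ₗ cutCommR (hIbY i h) (hBdY i h) (𝔮 U)) := by
  rw [KhBQY, deltaLocQY, cutCommR_add, cutCommR_add, hessY, cutCommR_add, cutCommR_coCurl_jordan_curl, cutCommR_gradY_divY,
    cutCommR_qs_aY_q i (hBdY i h) (hIbY i h)]

/-- ★ **THE (3.105)-TYPE SUM AT THE GENERIC PAIR, ALGEBRAIC CORE**: for any family of cube letters `G_□` and cut-offs `h_□` (read on bonds),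
`Δ_a[𝔮] · Σ_□ h_□G_□h_□ = Σ_□ h_□Δ_a[𝔮]G_□h_□ − Σ_□ (K[𝔮](h_□) + P₁(∂h_□)) G_□h_□`. [cite: Balaban1985BackgroundPropagators, (3.105) p.414] -/
theorem deltaAQY_comp_sum (𝔮 : QLetterY 𝔸 i) (𝔮s : QsLetterY 𝔸 i) (parS : SiteParY 𝔸 i) (Gp : SiteOpY 𝔸 i) (U : CfgY 𝔸 i) {κ : Type} (s : Finset κ)
    (hf : κ → SiteY i → ℝ) (Gl : κ → (FBondY i → 𝔸) →ₗ[ℂ] (FBondY i → 𝔸)) :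
    deltaAQY i 𝔮 𝔮s parS Gp U ∘ₗ (∑ k ∈ s, cutMulY (hBdY i (hf k)) ∘ₗ Gl k ∘ₗ cutMulY (hBdY i (hf k)))
      = (∑ k ∈ s, cutMulY (hBdY i (hf k)) ∘ₗ deltaAQY i 𝔮 𝔮s parS Gp U ∘ₗ Gl k ∘ₗ cutMulY (hBdY i (hf k)))
        - ∑ k ∈ s, (KhBQY i (hf k) 𝔮 𝔮s U + P1Y i (hf k) parS Gp U) ∘ₗ Gl k ∘ₗ cutMulY (hBdY i (hf k)) := by
  refine LinearMap.ext fun Λ => ?_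
  have hk : ∀ (k : κ) (v : FBondY i → 𝔸), deltaAQY i 𝔮 𝔮s parS Gp U (cutMulY (hBdY i (hf k)) v)
      = cutMulY (hBdY i (hf k)) (deltaAQY i 𝔮 𝔮s parS Gp U v) - KhBQY i (hf k) 𝔮 𝔮s U v - P1Y i (hf k) parS Gp U v := fun k v => by
    have e := LinearMap.congr_fun (deltaAQY_comp_cutMulY i (hf k) 𝔮 𝔮s parS Gp U) v
    simpa only [LinearMap.comp_apply, LinearMap.sub_apply] using e
  simp only [LinearMap.comp_apply, LinearMap.sum_apply, LinearMap.sub_apply, LinearMap.add_apply, map_sum, hk]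
  rw [← Finset.sum_sub_distrib]
  refine Finset.sum_congr rfl fun k _ => ?_
  abel

end Kh

/-! ## §2 (3.105) and its transpose at `Δ_a[𝔮](U)` with a defect family: generic partition, partition of record, exact laws -/

section Generic

/-- ★ **(3.105) AT `Δ_a[𝔮](U)` WITH A DEFECT FAMILY, GENERIC FORM**: for ANY real family `hf` with `Σ_□ hf_□² = 1` (read on bonds at `b₋`), ANY cut-offs `ζ_□ = 1` wherever
`hf_□ ≠ 0`, ANY cube letters `Gl_□`, local projection letters `Pl_□` with commutators `P1l_□` (`Pl_□·M_h = M_h·Pl_□ + P1l_□`, (3.101)), and defects `E_□` with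
`M_h(Δ_loc[𝔮](U) − Pl_□)Gl_□M_h = M_h² − E_□`:
`Δ_a[𝔮](U)·Σ_□ h_□Gl_□h_□ = 1 − Σ_□K[𝔮](h_□)(U)Gl_□h_□ − Σ_□(1 − ζ_□)DPD*(U)(h_□Gl_□h_□) − Σ_□ζ_□(DPD*(U) − Pl_□)(h_□Gl_□h_□) − Σ_□ζ_□P1l_□Gl_□h_□ − Σ_□E_□`.
DEFECT LABEL: the defect family is an (R)-design term of `B9Eq3105OfLocalInverse`, NOT in print; `= 0` for print's `G_□` on the cube sequence (p. 409 l. 3–5).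
[cite: Balaban1985BackgroundPropagators, (3.105) p.414, (3.104) p.414, (3.101) p.414, (3.87) p.409, p.408 («Σ h_□² = 1»)] -/
theorem eq3105_deltaAQY_defect (𝔮 : QLetterY 𝔸 i) (𝔮s : QsLetterY 𝔸 i) (parS : SiteParY 𝔸 i) (Gp : SiteOpY 𝔸 i) (U : CfgY 𝔸 i) {κ : Type} [Fintype κ]
    (hf : κ → SiteY i → ℝ) (hsq : ∀ z, ∑ c, hf c z ^ 2 = 1) (ζ : κ → SiteY i → ℝ) (hζ : ∀ c z, hf c z ≠ 0 → ζ c z = 1)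
    (Gl Pl P1l E : κ → Module.End ℂ (FBondY i → 𝔸))
    (hP1 : ∀ c, Pl c * cutMulY (hBdY i (hf c)) = cutMulY (hBdY i (hf c)) * Pl c + P1l c)
    (hdef : ∀ c, cutMulY (hBdY i (hf c)) * (deltaLocQY i 𝔮 𝔮s U - Pl c) * Gl c * cutMulY (hBdY i (hf c)) =
      cutMulY (hBdY i (hf c)) * cutMulY (hBdY i (hf c)) - E c) :
    deltaAQY i 𝔮 𝔮s parS Gp U * ∑ c, cutMulY (hBdY i (hf c)) * Gl c * cutMulY (hBdY i (hf c)) =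
      1 - ∑ c, KhBQY i (hf c) 𝔮 𝔮s U * Gl c * cutMulY (hBdY i (hf c))
        - ∑ c, (1 - cutMulY (hBdY i (ζ c))) * DPDsY i parS Gp U * (cutMulY (hBdY i (hf c)) * Gl c * cutMulY (hBdY i (hf c)))
        - ∑ c, cutMulY (hBdY i (ζ c)) * (DPDsY i parS Gp U - Pl c) * (cutMulY (hBdY i (hf c)) * Gl c * cutMulY (hBdY i (hf c)))
        - ∑ c, cutMulY (hBdY i (ζ c)) * P1l c * Gl c * cutMulY (hBdY i (hf c))
        - ∑ c, E c := by
  rw [deltaAQY_eq_loc_sub]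
  exact eq3105_sum_defect (deltaLocQY i 𝔮 𝔮s U) (DPDsY i parS Gp U) (fun c => cutMulY (hBdY i (hf c))) (fun c => cutMulY (hBdY i (ζ c)))
    Gl (fun c => KhBQY i (hf c) 𝔮 𝔮s U) Pl P1l E (fun c => deltaLocQY_mul_cutMulY i (hf c) 𝔮 𝔮s U) hP1
    (fun c => cutMulY_mul_cutMulY_of_eq_one (hBdY i (ζ c)) (hBdY i (hf c)) fun b hb => hζ c (chartY i b.src) hb) hdef
    (sum_cutMulY_mul_self (fun c => hBdY i (hf c)) fun b => hsq (chartY i b.src))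

/-- ★ **(3.105) TRANSPOSED AT `Δ_a[𝔮](U)` WITH A DEFECT FAMILY, GENERIC FORM**: data as in `eq3105_deltaAQY_defect`, RIGHT defects `E♯_□` with
`M_hGl_□(Δ_loc[𝔮](U) − Pl_□)M_h = M_h² − E♯_□`:
`(Σ_□ h_□Gl_□h_□)·Δ_a[𝔮](U) = 1 + Σ_□ h_□Gl_□K[𝔮](h_□)(U) + Σ_□ h_□Gl_□P1l_□ − Σ_□ h_□Gl_□h_□·ζ_□(DPD*(U) − Pl_□) − Σ_□ h_□Gl_□h_□·(1 − ζ_□)DPD*(U) − Σ_□E♯_□`.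
(transposed reading — bookkeeping; print displays only the left form of (3.105); defect label as above) [cite: Balaban1985BackgroundPropagators, (3.105) p.414, (3.104) p.414, (3.101) p.414, (3.87) p.409, p.408] -/
theorem eq3105T_deltaAQY_defect (𝔮 : QLetterY 𝔸 i) (𝔮s : QsLetterY 𝔸 i) (parS : SiteParY 𝔸 i) (Gp : SiteOpY 𝔸 i) (U : CfgY 𝔸 i) {κ : Type} [Fintype κ]
    (hf : κ → SiteY i → ℝ) (hsq : ∀ z, ∑ c, hf c z ^ 2 = 1) (ζ : κ → SiteY i → ℝ) (hζ : ∀ c z, hf c z ≠ 0 → ζ c z = 1)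
    (Gl Pl P1l E : κ → Module.End ℂ (FBondY i → 𝔸))
    (hP1 : ∀ c, Pl c * cutMulY (hBdY i (hf c)) = cutMulY (hBdY i (hf c)) * Pl c + P1l c)
    (hdefT : ∀ c, cutMulY (hBdY i (hf c)) * Gl c * (deltaLocQY i 𝔮 𝔮s U - Pl c) * cutMulY (hBdY i (hf c)) =
      cutMulY (hBdY i (hf c)) * cutMulY (hBdY i (hf c)) - E c) :
    (∑ c, cutMulY (hBdY i (hf c)) * Gl c * cutMulY (hBdY i (hf c))) * deltaAQY i 𝔮 𝔮s parS Gp U =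
      1 + ∑ c, cutMulY (hBdY i (hf c)) * Gl c * KhBQY i (hf c) 𝔮 𝔮s U
        + ∑ c, cutMulY (hBdY i (hf c)) * Gl c * P1l c
        - ∑ c, cutMulY (hBdY i (hf c)) * Gl c * cutMulY (hBdY i (hf c)) * (cutMulY (hBdY i (ζ c)) * (DPDsY i parS Gp U - Pl c))
        - ∑ c, cutMulY (hBdY i (hf c)) * Gl c * cutMulY (hBdY i (hf c)) * ((1 - cutMulY (hBdY i (ζ c))) * DPDsY i parS Gp U)
        - ∑ c, E c := by
  rw [deltaAQY_eq_loc_sub]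
  exact eq3105T_sum_defect (deltaLocQY i 𝔮 𝔮s U) (DPDsY i parS Gp U) (fun c => cutMulY (hBdY i (hf c))) (fun c => cutMulY (hBdY i (ζ c)))
    Gl (fun c => KhBQY i (hf c) 𝔮 𝔮s U) Pl P1l E (fun c => deltaLocQY_mul_cutMulY i (hf c) 𝔮 𝔮s U) hP1
    (fun c => cutMulY_mul_cutMulY_of_eq_one' (hBdY i (hf c)) (hBdY i (ζ c)) fun b hb => hζ c (chartY i b.src) hb) hdefT
    (sum_cutMulY_mul_self (fun c => hBdY i (hf c)) fun b => hsq (chartY i b.src))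

end Generic

section Record

/-- (3.105) with a defect family at `Δ_a[𝔮](U)` and the partition of record `h_□ = hTY i □` (`Σ_□ h_□² = 1`: `sum_hTY_sq`), the cube index = the cover cubes of record.
(defect label as in `eq3105_deltaAQY_defect`) [cite: Balaban1985BackgroundPropagators, (3.105) p.414, (3.87) p.409, p.408] -/
theorem eq3105Q_hT_defect (𝔮 : QLetterY 𝔸 i) (𝔮s : QsLetterY 𝔸 i) (parS : SiteParY 𝔸 i) (Gp : SiteOpY 𝔸 i) (U : CfgY 𝔸 i)
    (ζ : ↥(cubes i.D.toDomains) → SiteY i → ℝ) (hζ : ∀ c z, hTY i c z ≠ 0 → ζ c z = 1)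
    (Gl Pl P1l E : ↥(cubes i.D.toDomains) → Module.End ℂ (FBondY i → 𝔸))
    (hP1 : ∀ c, Pl c * cutMulY (hBdY i (hTY i c)) = cutMulY (hBdY i (hTY i c)) * Pl c + P1l c)
    (hdef : ∀ c, cutMulY (hBdY i (hTY i c)) * (deltaLocQY i 𝔮 𝔮s U - Pl c) * Gl c * cutMulY (hBdY i (hTY i c)) =
      cutMulY (hBdY i (hTY i c)) * cutMulY (hBdY i (hTY i c)) - E c) :
    deltaAQY i 𝔮 𝔮s parS Gp U * ∑ c, cutMulY (hBdY i (hTY i c)) * Gl c * cutMulY (hBdY i (hTY i c)) =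
      1 - ∑ c, KhBQY i (hTY i c) 𝔮 𝔮s U * Gl c * cutMulY (hBdY i (hTY i c))
        - ∑ c, (1 - cutMulY (hBdY i (ζ c))) * DPDsY i parS Gp U * (cutMulY (hBdY i (hTY i c)) * Gl c * cutMulY (hBdY i (hTY i c)))
        - ∑ c, cutMulY (hBdY i (ζ c)) * (DPDsY i parS Gp U - Pl c) * (cutMulY (hBdY i (hTY i c)) * Gl c * cutMulY (hBdY i (hTY i c)))
        - ∑ c, cutMulY (hBdY i (ζ c)) * P1l c * Gl c * cutMulY (hBdY i (hTY i c))
        - ∑ c, E c :=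
  eq3105_deltaAQY_defect i 𝔮 𝔮s parS Gp U (hTY i) (sum_hTY_sq i) ζ hζ Gl Pl P1l E hP1 hdef

/-- (3.105) transposed with a defect family at `Δ_a[𝔮](U)` and the partition of record. (transposed reading — bookkeeping; print displays only the left form of (3.105); defect label as above)
[cite: Balaban1985BackgroundPropagators, (3.105) p.414, (3.87) p.409, p.408] -/
theorem eq3105QT_hT_defect (𝔮 : QLetterY 𝔸 i) (𝔮s : QsLetterY 𝔸 i) (parS : SiteParY 𝔸 i) (Gp : SiteOpY 𝔸 i) (U : CfgY 𝔸 i)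
    (ζ : ↥(cubes i.D.toDomains) → SiteY i → ℝ) (hζ : ∀ c z, hTY i c z ≠ 0 → ζ c z = 1)
    (Gl Pl P1l E : ↥(cubes i.D.toDomains) → Module.End ℂ (FBondY i → 𝔸))
    (hP1 : ∀ c, Pl c * cutMulY (hBdY i (hTY i c)) = cutMulY (hBdY i (hTY i c)) * Pl c + P1l c)
    (hdefT : ∀ c, cutMulY (hBdY i (hTY i c)) * Gl c * (deltaLocQY i 𝔮 𝔮s U - Pl c) * cutMulY (hBdY i (hTY i c)) =
      cutMulY (hBdY i (hTY i c)) * cutMulY (hBdY i (hTY i c)) - E c) :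
    (∑ c, cutMulY (hBdY i (hTY i c)) * Gl c * cutMulY (hBdY i (hTY i c))) * deltaAQY i 𝔮 𝔮s parS Gp U =
      1 + ∑ c, cutMulY (hBdY i (hTY i c)) * Gl c * KhBQY i (hTY i c) 𝔮 𝔮s U
        + ∑ c, cutMulY (hBdY i (hTY i c)) * Gl c * P1l c
        - ∑ c, cutMulY (hBdY i (hTY i c)) * Gl c * cutMulY (hBdY i (hTY i c)) * (cutMulY (hBdY i (ζ c)) * (DPDsY i parS Gp U - Pl c))
        - ∑ c, cutMulY (hBdY i (hTY i c)) * Gl c * cutMulY (hBdY i (hTY i c)) * ((1 - cutMulY (hBdY i (ζ c))) * DPDsY i parS Gp U)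
        - ∑ c, E c :=
  eq3105T_deltaAQY_defect i 𝔮 𝔮s parS Gp U (hTY i) (sum_hTY_sq i) ζ hζ Gl Pl P1l E hP1 hdefT

/-- the EXACT-law specialisation (`E ≡ 0`) at the generic pair: (3.105) at the partition of record for generic letters with `M_h(Δ_loc[𝔮] − Pl_□)Gl_□M_h = M_h²` — the four
printed families only. [cite: Balaban1985BackgroundPropagators, (3.105) p.414, (3.87) p.409, p.408] -/
theorem eq3105Q_hT_ofLocalInverse (𝔮 : QLetterY 𝔸 i) (𝔮s : QsLetterY 𝔸 i) (parS : SiteParY 𝔸 i) (Gp : SiteOpY 𝔸 i) (U : CfgY 𝔸 i)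
    (ζ : ↥(cubes i.D.toDomains) → SiteY i → ℝ) (hζ : ∀ c z, hTY i c z ≠ 0 → ζ c z = 1)
    (Gl Pl P1l : ↥(cubes i.D.toDomains) → Module.End ℂ (FBondY i → 𝔸))
    (hP1 : ∀ c, Pl c * cutMulY (hBdY i (hTY i c)) = cutMulY (hBdY i (hTY i c)) * Pl c + P1l c)
    (hloc : ∀ c, cutMulY (hBdY i (hTY i c)) * (deltaLocQY i 𝔮 𝔮s U - Pl c) * Gl c * cutMulY (hBdY i (hTY i c)) =
      cutMulY (hBdY i (hTY i c)) * cutMulY (hBdY i (hTY i c))) :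
    deltaAQY i 𝔮 𝔮s parS Gp U * ∑ c, cutMulY (hBdY i (hTY i c)) * Gl c * cutMulY (hBdY i (hTY i c)) =
      1 - ∑ c, KhBQY i (hTY i c) 𝔮 𝔮s U * Gl c * cutMulY (hBdY i (hTY i c))
        - ∑ c, (1 - cutMulY (hBdY i (ζ c))) * DPDsY i parS Gp U * (cutMulY (hBdY i (hTY i c)) * Gl c * cutMulY (hBdY i (hTY i c)))
        - ∑ c, cutMulY (hBdY i (ζ c)) * (DPDsY i parS Gp U - Pl c) * (cutMulY (hBdY i (hTY i c)) * Gl c * cutMulY (hBdY i (hTY i c)))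
        - ∑ c, cutMulY (hBdY i (ζ c)) * P1l c * Gl c * cutMulY (hBdY i (hTY i c)) := by
  have h := eq3105Q_hT_defect i 𝔮 𝔮s parS Gp U ζ hζ Gl Pl P1l (fun _ => 0) hP1 (fun c => by rw [hloc c, sub_zero])
  rw [Finset.sum_const_zero, sub_zero] at h
  exact h

/-- the EXACT-law specialisation of the transposed identity at the generic pair (`E♯ ≡ 0`). (transposed reading — bookkeeping; print displays only the left form of (3.105))
[cite: Balaban1985BackgroundPropagators, (3.105) p.414, (3.87) p.409, p.408] -/
theorem eq3105QT_hT_ofLocalInverse (𝔮 : QLetterY 𝔸 i) (𝔮s : QsLetterY 𝔸 i) (parS : SiteParY 𝔸 i) (Gp : SiteOpY 𝔸 i) (U : CfgY 𝔸 i)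
    (ζ : ↥(cubes i.D.toDomains) → SiteY i → ℝ) (hζ : ∀ c z, hTY i c z ≠ 0 → ζ c z = 1)
    (Gl Pl P1l : ↥(cubes i.D.toDomains) → Module.End ℂ (FBondY i → 𝔸))
    (hP1 : ∀ c, Pl c * cutMulY (hBdY i (hTY i c)) = cutMulY (hBdY i (hTY i c)) * Pl c + P1l c)
    (hlocT : ∀ c, cutMulY (hBdY i (hTY i c)) * Gl c * (deltaLocQY i 𝔮 𝔮s U - Pl c) * cutMulY (hBdY i (hTY i c)) =
      cutMulY (hBdY i (hTY i c)) * cutMulY (hBdY i (hTY i c))) :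
    (∑ c, cutMulY (hBdY i (hTY i c)) * Gl c * cutMulY (hBdY i (hTY i c))) * deltaAQY i 𝔮 𝔮s parS Gp U =
      1 + ∑ c, cutMulY (hBdY i (hTY i c)) * Gl c * KhBQY i (hTY i c) 𝔮 𝔮s U
        + ∑ c, cutMulY (hBdY i (hTY i c)) * Gl c * P1l c
        - ∑ c, cutMulY (hBdY i (hTY i c)) * Gl c * cutMulY (hBdY i (hTY i c)) * (cutMulY (hBdY i (ζ c)) * (DPDsY i parS Gp U - Pl c))
        - ∑ c, cutMulY (hBdY i (hTY i c)) * Gl c * cutMulY (hBdY i (hTY i c)) * ((1 - cutMulY (hBdY i (ζ c))) * DPDsY i parS Gp U) := by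
  have h := eq3105QT_hT_defect i 𝔮 𝔮s parS Gp U ζ hζ Gl Pl P1l (fun _ => 0) hP1 (fun c => by rw [hlocT c, sub_zero])
  rw [Finset.sum_const_zero, sub_zero] at h
  exact h

end Record

/-! ## §3 `End_ℂ → End_ℝ`, and lit's real coordinates `conj b` (the `h388 ∕ h388T` shapes at the generic pair) -/

section Restrict

/-- ★ **(3.105) AT `Δ_a[𝔮]` WITH THE DEFECT FAMILY IN `End_ℝ`**: `eq3105Q_hT_defect` read after `restrictScalars ℝ`. (defect label as above)
[cite: Balaban1985BackgroundPropagators, (3.105) p.414, (3.87) p.409] -/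
theorem eq3105Q_restrict_defect (𝔮 : QLetterY 𝔸 i) (𝔮s : QsLetterY 𝔸 i) (parS : SiteParY 𝔸 i) (Gp : SiteOpY 𝔸 i) (U : CfgY 𝔸 i)
    (ζ : ↥(cubes i.D.toDomains) → SiteY i → ℝ) (hζ : ∀ c z, hTY i c z ≠ 0 → ζ c z = 1)
    (Gl Pl P1l E : ↥(cubes i.D.toDomains) → Module.End ℂ (FBondY i → 𝔸))
    (hP1 : ∀ c, Pl c * cutMulY (hBdY i (hTY i c)) = cutMulY (hBdY i (hTY i c)) * Pl c + P1l c)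
    (hdef : ∀ c, cutMulY (hBdY i (hTY i c)) * (deltaLocQY i 𝔮 𝔮s U - Pl c) * Gl c * cutMulY (hBdY i (hTY i c)) =
      cutMulY (hBdY i (hTY i c)) * cutMulY (hBdY i (hTY i c)) - E c) :
    (deltaAQY i 𝔮 𝔮s parS Gp U).restrictScalars ℝ *
        (∑ c, (cutMulY (𝔸 := 𝔸) (hBdY i (hTY i c))).restrictScalars ℝ * (Gl c).restrictScalars ℝ *
          (cutMulY (𝔸 := 𝔸) (hBdY i (hTY i c))).restrictScalars ℝ) =
      1 - ∑ c, (KhBQY i (hTY i c) 𝔮 𝔮s U * Gl c * cutMulY (hBdY i (hTY i c))).restrictScalars ℝ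
        - ∑ c, ((1 - cutMulY (hBdY i (ζ c))) * DPDsY i parS Gp U *
            (cutMulY (hBdY i (hTY i c)) * Gl c * cutMulY (hBdY i (hTY i c)))).restrictScalars ℝ
        - ∑ c, (cutMulY (hBdY i (ζ c)) * (DPDsY i parS Gp U - Pl c) *
            (cutMulY (hBdY i (hTY i c)) * Gl c * cutMulY (hBdY i (hTY i c)))).restrictScalars ℝ
        - ∑ c, (cutMulY (hBdY i (ζ c)) * P1l c * Gl c * cutMulY (hBdY i (hTY i c))).restrictScalars ℝ
        - ∑ c, (E c).restrictScalars ℝ := by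
  refine LinearMap.ext fun Λ => ?_
  have h := LinearMap.congr_fun (eq3105Q_hT_defect i 𝔮 𝔮s parS Gp U ζ hζ Gl Pl P1l E hP1 hdef) Λ
  simp only [Module.End.mul_apply, LinearMap.sum_apply, LinearMap.sub_apply, Module.End.one_apply, LinearMap.restrictScalars_apply] at h ⊢
  exact h

/-- ★ **THE TRANSPOSED (3.105) AT `Δ_a[𝔮]` WITH THE DEFECT FAMILY IN `End_ℝ`**. (transposed reading — bookkeeping; print displays only the left form of (3.105); defect label as above)
[cite: Balaban1985BackgroundPropagators, (3.105) p.414, (3.87) p.409] -/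
theorem eq3105QT_restrict_defect (𝔮 : QLetterY 𝔸 i) (𝔮s : QsLetterY 𝔸 i) (parS : SiteParY 𝔸 i) (Gp : SiteOpY 𝔸 i) (U : CfgY 𝔸 i)
    (ζ : ↥(cubes i.D.toDomains) → SiteY i → ℝ) (hζ : ∀ c z, hTY i c z ≠ 0 → ζ c z = 1)
    (Gl Pl P1l E : ↥(cubes i.D.toDomains) → Module.End ℂ (FBondY i → 𝔸))
    (hP1 : ∀ c, Pl c * cutMulY (hBdY i (hTY i c)) = cutMulY (hBdY i (hTY i c)) * Pl c + P1l c)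
    (hdefT : ∀ c, cutMulY (hBdY i (hTY i c)) * Gl c * (deltaLocQY i 𝔮 𝔮s U - Pl c) * cutMulY (hBdY i (hTY i c)) =
      cutMulY (hBdY i (hTY i c)) * cutMulY (hBdY i (hTY i c)) - E c) :
    (∑ c, (cutMulY (𝔸 := 𝔸) (hBdY i (hTY i c))).restrictScalars ℝ * (Gl c).restrictScalars ℝ *
          (cutMulY (𝔸 := 𝔸) (hBdY i (hTY i c))).restrictScalars ℝ) * (deltaAQY i 𝔮 𝔮s parS Gp U).restrictScalars ℝ =
      1 + ∑ c, (cutMulY (hBdY i (hTY i c)) * Gl c * KhBQY i (hTY i c) 𝔮 𝔮s U).restrictScalars ℝ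
        + ∑ c, (cutMulY (hBdY i (hTY i c)) * Gl c * P1l c).restrictScalars ℝ
        - ∑ c, (cutMulY (hBdY i (hTY i c)) * Gl c * cutMulY (hBdY i (hTY i c)) *
            (cutMulY (hBdY i (ζ c)) * (DPDsY i parS Gp U - Pl c))).restrictScalars ℝ
        - ∑ c, (cutMulY (hBdY i (hTY i c)) * Gl c * cutMulY (hBdY i (hTY i c)) *
            ((1 - cutMulY (hBdY i (ζ c))) * DPDsY i parS Gp U)).restrictScalars ℝ
        - ∑ c, (E c).restrictScalars ℝ := by
  refine LinearMap.ext fun Λ => ?_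
  have h := LinearMap.congr_fun (eq3105QT_hT_defect i 𝔮 𝔮s parS Gp U ζ hζ Gl Pl P1l E hP1 hdefT) Λ
  simp only [Module.End.mul_apply, LinearMap.sum_apply, LinearMap.sub_apply, LinearMap.add_apply, Module.End.one_apply,
    LinearMap.restrictScalars_apply] at h ⊢
  exact h

end Restrict

section Conj

variable {ι : Type} [Fintype ι] (b : Module.Basis ι ℝ 𝔸)

/-- ★ **(3.105) AT `Δ_a[𝔮]` WITH THE DEFECT FAMILY IN REAL COORDINATES** (`h_□` as `mulOp (h_□ ∘ fst)`, cube letters as `conj b Gl_□`): the `h388` input shape of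
`B9Thm310GTorusRegular.thm310_entry1` ∕ `…Entries.thm310_leftEntry` for generic letters, now at the generic pair. (defect label as above)
[cite: Balaban1985BackgroundPropagators, (3.105) p.414, (3.87) p.409; Balaban1984PropagatorsII, (2.52) p.232] -/
theorem eq3105Q_conj_defect (𝔮 : QLetterY 𝔸 i) (𝔮s : QsLetterY 𝔸 i) (parS : SiteParY 𝔸 i) (Gp : SiteOpY 𝔸 i) (U : CfgY 𝔸 i)
    (ζ : ↥(cubes i.D.toDomains) → SiteY i → ℝ) (hζ : ∀ c z, hTY i c z ≠ 0 → ζ c z = 1)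
    (Gl Pl P1l E : ↥(cubes i.D.toDomains) → Module.End ℂ (FBondY i → 𝔸))
    (hP1 : ∀ c, Pl c * cutMulY (hBdY i (hTY i c)) = cutMulY (hBdY i (hTY i c)) * Pl c + P1l c)
    (hdef : ∀ c, cutMulY (hBdY i (hTY i c)) * (deltaLocQY i 𝔮 𝔮s U - Pl c) * Gl c * cutMulY (hBdY i (hTY i c)) =
      cutMulY (hBdY i (hTY i c)) * cutMulY (hBdY i (hTY i c)) - E c) :
    conj b ((deltaAQY i 𝔮 𝔮s parS Gp U).restrictScalars ℝ) *
        (∑ c, mulOp (fun p : FBondY i × ι => hBdY i (hTY i c) p.1) * conj b ((Gl c).restrictScalars ℝ) *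
          mulOp (fun p : FBondY i × ι => hBdY i (hTY i c) p.1)) =
      1 - (∑ c, conj b ((KhBQY i (hTY i c) 𝔮 𝔮s U * Gl c * cutMulY (hBdY i (hTY i c))).restrictScalars ℝ)
        + ∑ c, conj b (((1 - cutMulY (hBdY i (ζ c))) * DPDsY i parS Gp U *
            (cutMulY (hBdY i (hTY i c)) * Gl c * cutMulY (hBdY i (hTY i c)))).restrictScalars ℝ)
        + ∑ c, conj b ((cutMulY (hBdY i (ζ c)) * (DPDsY i parS Gp U - Pl c) *
            (cutMulY (hBdY i (hTY i c)) * Gl c * cutMulY (hBdY i (hTY i c)))).restrictScalars ℝ)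
        + ∑ c, conj b ((cutMulY (hBdY i (ζ c)) * P1l c * Gl c * cutMulY (hBdY i (hTY i c))).restrictScalars ℝ)
        + ∑ c, conj b ((E c).restrictScalars ℝ)) := by
  have h := congrArg (conj b) (eq3105Q_restrict_defect i 𝔮 𝔮s parS Gp U ζ hζ Gl Pl P1l E hP1 hdef)
  rw [B9Eq352DivFormLetters.conj_mul, conj_sum] at h
  simp only [B9Eq352DivFormLetters.conj_mul, conj_cutMulY, conj_sub, conj_one, conj_sum] at h
  rw [h]
  abel

/-- ★ **THE TRANSPOSED (3.105) AT `Δ_a[𝔮]` WITH THE DEFECT FAMILY IN REAL COORDINATES**: the `h388T` input shape of `…Entries.thm310_rightEntry` for generic letters at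
the generic pair. (transposed reading — bookkeeping; print displays only the left form of (3.105); defect label as above) [cite: Balaban1985BackgroundPropagators, (3.105) p.414, (3.87) p.409; Balaban1984PropagatorsII, (2.52) p.232] -/
theorem eq3105QT_conj_defect (𝔮 : QLetterY 𝔸 i) (𝔮s : QsLetterY 𝔸 i) (parS : SiteParY 𝔸 i) (Gp : SiteOpY 𝔸 i) (U : CfgY 𝔸 i)
    (ζ : ↥(cubes i.D.toDomains) → SiteY i → ℝ) (hζ : ∀ c z, hTY i c z ≠ 0 → ζ c z = 1)
    (Gl Pl P1l E : ↥(cubes i.D.toDomains) → Module.End ℂ (FBondY i → 𝔸))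
    (hP1 : ∀ c, Pl c * cutMulY (hBdY i (hTY i c)) = cutMulY (hBdY i (hTY i c)) * Pl c + P1l c)
    (hdefT : ∀ c, cutMulY (hBdY i (hTY i c)) * Gl c * (deltaLocQY i 𝔮 𝔮s U - Pl c) * cutMulY (hBdY i (hTY i c)) =
      cutMulY (hBdY i (hTY i c)) * cutMulY (hBdY i (hTY i c)) - E c) :
    (∑ c, mulOp (fun p : FBondY i × ι => hBdY i (hTY i c) p.1) * conj b ((Gl c).restrictScalars ℝ) *
          mulOp (fun p : FBondY i × ι => hBdY i (hTY i c) p.1)) * conj b ((deltaAQY i 𝔮 𝔮s parS Gp U).restrictScalars ℝ) =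
      1 - (-(∑ c, conj b ((cutMulY (hBdY i (hTY i c)) * Gl c * KhBQY i (hTY i c) 𝔮 𝔮s U).restrictScalars ℝ))
        - ∑ c, conj b ((cutMulY (hBdY i (hTY i c)) * Gl c * P1l c).restrictScalars ℝ)
        + ∑ c, conj b ((cutMulY (hBdY i (hTY i c)) * Gl c * cutMulY (hBdY i (hTY i c)) *
            (cutMulY (hBdY i (ζ c)) * (DPDsY i parS Gp U - Pl c))).restrictScalars ℝ)
        + ∑ c, conj b ((cutMulY (hBdY i (hTY i c)) * Gl c * cutMulY (hBdY i (hTY i c)) *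
            ((1 - cutMulY (hBdY i (ζ c))) * DPDsY i parS Gp U)).restrictScalars ℝ)
        + ∑ c, conj b ((E c).restrictScalars ℝ)) := by
  have h := congrArg (conj b) (eq3105QT_restrict_defect i 𝔮 𝔮s parS Gp U ζ hζ Gl Pl P1l E hP1 hdefT)
  rw [B9Eq352DivFormLetters.conj_mul, conj_sum] at h
  simp only [B9Eq352DivFormLetters.conj_mul, conj_cutMulY, conj_sub, conj_add, conj_one, conj_sum] at h
  rw [h]
  abel

end Conj

/-! ## §4 Through dag-n06-d's algebra morphism `coordAlgHomB`: the identities in the record's `S0coKq ∕ GcoK ∕ mulOp` currency -/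

section CoordsB

variable [FiniteDimensional ℝ 𝔸] {κ : Type} [Fintype κ]
variable (b : Module.Basis κ ℝ 𝔸) (B : B9.Backgrounds) (cfg : B.Cfg → CfgY 𝔸 i)

/-- the record's scaled model `S0coKq` of `Δ_a[𝔮]` IS `c_R(b)⁻¹ • coordAlgHomB (Δ_a[𝔮](U))` (definitionally). [cite: Balaban1985BackgroundPropagators, (3.26) p.395, p.421 («G₀»), dictionary] -/
theorem S0coKq_eq_smul_coordAlgHomB (𝔮 : QLetterY 𝔸 i) (𝔮s : QsLetterY 𝔸 i) (parS : SiteParY 𝔸 i) (Gp : SiteOpY 𝔸 i) (U₁ : B.Cfg) :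
    S0coKq i b B cfg 𝔮 𝔮s parS Gp U₁ = (cR39 b)⁻¹ • coordAlgHomB i b (deltaAQY i 𝔮 𝔮s parS Gp (cfg U₁)) := rfl

/-- the record's scaled model `GcoK` of a bond letter `O` IS `c_R(b) • coordAlgHomB (O(U))` (definitionally). [cite: Balaban1985BackgroundPropagators, (3.42) p.397, dictionary] -/
theorem GcoK_eq_smul_coordAlgHomB (O : BondOpY 𝔸 i) (U₁ : B.Cfg) :
    GcoK i b B cfg O U₁ = cR39 b • coordAlgHomB i b (O (cfg U₁)) := rfl

omit [CompleteSpace 𝔸] in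
/-- the scalings cancel: `(c⁻¹ • φΔ) * Σ_□ φM_□ * (c • φG_□) * φM_□ = φ(Δ * Σ_□ M_□G_□M_□)` for the algebra morphism `φ = coordAlgHomB`, `c = c_R(b) ≠ 0`.
[cite: Balaban1985BackgroundPropagators, (3.87) p.409, (3.42) p.397, bookkeeping] -/
theorem smul_mul_sum_smul_eq (hc : cR39 b ≠ 0) {K : Type} [Fintype K] (Δ : Module.End ℂ (FBondY i → 𝔸)) (M G : K → Module.End ℂ (FBondY i → 𝔸)) :
    ((cR39 b)⁻¹ • coordAlgHomB i b Δ) * (∑ c, coordAlgHomB i b (M c) * (cR39 b • coordAlgHomB i b (G c)) * coordAlgHomB i b (M c)) =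
      coordAlgHomB i b (Δ * ∑ c, M c * G c * M c) := by
  have hs : (∑ c, coordAlgHomB i b (M c) * (cR39 b • coordAlgHomB i b (G c)) * coordAlgHomB i b (M c)) =
      cR39 b • ∑ c, coordAlgHomB i b (M c * G c * M c) := by
    rw [Finset.smul_sum]
    refine Finset.sum_congr rfl fun c _ => ?_
    rw [map_mul, map_mul, mul_smul_comm, smul_mul_assoc]
  rw [hs, smul_mul_smul_comm, inv_mul_cancel₀ hc, one_smul, map_mul, map_sum]

omit [CompleteSpace 𝔸] in
/-- the same cancellation for the transposed product `(Σ_□ φM_□ * (c • φG_□) * φM_□) * (c⁻¹ • φΔ) = φ((Σ_□ M_□G_□M_□) * Δ)` (transposed reading — bookkeeping; print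
displays only the left form of (3.105)). [cite: Balaban1985BackgroundPropagators, (3.87) p.409, (3.42) p.397, bookkeeping] -/
theorem sum_smul_mul_smul_eq (hc : cR39 b ≠ 0) {K : Type} [Fintype K] (Δ : Module.End ℂ (FBondY i → 𝔸)) (M G : K → Module.End ℂ (FBondY i → 𝔸)) :
    (∑ c, coordAlgHomB i b (M c) * (cR39 b • coordAlgHomB i b (G c)) * coordAlgHomB i b (M c)) * ((cR39 b)⁻¹ • coordAlgHomB i b Δ) =
      coordAlgHomB i b ((∑ c, M c * G c * M c) * Δ) := by
  have hs : (∑ c, coordAlgHomB i b (M c) * (cR39 b • coordAlgHomB i b (G c)) * coordAlgHomB i b (M c)) =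
      cR39 b • ∑ c, coordAlgHomB i b (M c * G c * M c) := by
    rw [Finset.smul_sum]
    refine Finset.sum_congr rfl fun c _ => ?_
    rw [map_mul, map_mul, mul_smul_comm, smul_mul_assoc]
  rw [hs, smul_mul_smul_comm, mul_inv_cancel₀ hc, one_smul, map_mul, map_sum]

/-- ★★ **(3.105) AT `Δ_a[𝔮]` WITH THE DEFECT FAMILY, IN THE RECORD's COORDINATE LETTERS**: with the partition of record read on the bond carrier as the heads' `mulOp (hWalkBY x □)`
(`= mulOp (fun p => hTY i □ (chart p.1₋))`), the cube letters as `GcoK i b B cfg (Gl □) U₁` and `Δ_a[𝔮]` as `S0coKq i b B cfg 𝔮 𝔮s parS G′ U₁`: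
`S0coKq … U₁ * Σ_□ mulOp h_□ * GcoK … (Gl □) U₁ * mulOp h_□ = 1 − Σ_□ φ(K[𝔮](h_□)Gl_□h_□) − Σ_□ φ((1 − ζ_□)DPD*(h_□Gl_□h_□)) − Σ_□ φ(ζ_□(DPD* − Pl_□)(h_□Gl_□h_□)) −
Σ_□ φ(ζ_□P1l_□Gl_□h_□) − Σ_□ φ(E_□)`, `φ = coordAlgHomB i b` — the LITERAL left-hand side of the heads' `hlawsA`.3 once `ΔaA := S0coKq …` and `OcA := Gl`. (defect label as above)
[cite: Balaban1985BackgroundPropagators, (3.105) p.414, (3.87) p.409, (3.42) p.397; Balaban1984PropagatorsII, (2.52) p.232] -/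
theorem eq3105Q_coordsB_defect (hc : cR39 b ≠ 0) (𝔮 : QLetterY 𝔸 i) (𝔮s : QsLetterY 𝔸 i) (parS : SiteParY 𝔸 i) (Gp : SiteOpY 𝔸 i) (U₁ : B.Cfg)
    (ζ : ↥(cubes i.D.toDomains) → SiteY i → ℝ) (hζ : ∀ c z, hTY i c z ≠ 0 → ζ c z = 1)
    (Gl : ↥(cubes i.D.toDomains) → BondOpY 𝔸 i) (Pl P1l E : ↥(cubes i.D.toDomains) → Module.End ℂ (FBondY i → 𝔸))
    (hP1 : ∀ c, Pl c * cutMulY (hBdY i (hTY i c)) = cutMulY (hBdY i (hTY i c)) * Pl c + P1l c)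
    (hdef : ∀ c, cutMulY (hBdY i (hTY i c)) * (deltaLocQY i 𝔮 𝔮s (cfg U₁) - Pl c) * Gl c (cfg U₁) * cutMulY (hBdY i (hTY i c)) =
      cutMulY (hBdY i (hTY i c)) * cutMulY (hBdY i (hTY i c)) - E c) :
    S0coKq i b B cfg 𝔮 𝔮s parS Gp U₁ *
        (∑ c, mulOp (fun p : XBK κ i => hTY i c (chartY i p.1.src)) * GcoK i b B cfg (Gl c) U₁ * mulOp (fun p : XBK κ i => hTY i c (chartY i p.1.src))) =
      1 - ∑ c, coordAlgHomB i b (KhBQY i (hTY i c) 𝔮 𝔮s (cfg U₁) * Gl c (cfg U₁) * cutMulY (hBdY i (hTY i c)))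
        - ∑ c, coordAlgHomB i b ((1 - cutMulY (hBdY i (ζ c))) * DPDsY i parS Gp (cfg U₁) *
            (cutMulY (hBdY i (hTY i c)) * Gl c (cfg U₁) * cutMulY (hBdY i (hTY i c))))
        - ∑ c, coordAlgHomB i b (cutMulY (hBdY i (ζ c)) * (DPDsY i parS Gp (cfg U₁) - Pl c) *
            (cutMulY (hBdY i (hTY i c)) * Gl c (cfg U₁) * cutMulY (hBdY i (hTY i c))))
        - ∑ c, coordAlgHomB i b (cutMulY (hBdY i (ζ c)) * P1l c * Gl c (cfg U₁) * cutMulY (hBdY i (hTY i c)))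
        - ∑ c, coordAlgHomB i b (E c) := by
  have eM : ∀ c : ↥(cubes i.D.toDomains),
      mulOp (fun p : XBK κ i => hTY i c (chartY i p.1.src)) = coordAlgHomB i b (cutMulY (𝔸 := 𝔸) (hBdY i (hTY i c))) :=
    fun c => mulOp_bond_eq_coordOpK i b (hTY i c)
  simp only [eM, S0coKq_eq_smul_coordAlgHomB, GcoK_eq_smul_coordAlgHomB]
  rw [smul_mul_sum_smul_eq i b hc, eq3105Q_hT_defect i 𝔮 𝔮s parS Gp (cfg U₁) ζ hζ (fun c => Gl c (cfg U₁)) Pl P1l E hP1 hdef]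
  simp only [map_sub, map_sum, map_one]

/-- ★★ **THE TRANSPOSED (3.105) AT `Δ_a[𝔮]` WITH THE DEFECT FAMILY, IN THE RECORD's COORDINATE LETTERS** — the LITERAL left-hand side of the heads' `hlawsA`.4 once
`ΔaA := S0coKq …` and `OcA := Gl`. (transposed reading — bookkeeping; print displays only the left form of (3.105); defect label as above)
[cite: Balaban1985BackgroundPropagators, (3.105) p.414, (3.87) p.409, (3.42) p.397; Balaban1984PropagatorsII, (2.52) p.232] -/
theorem eq3105QT_coordsB_defect (hc : cR39 b ≠ 0) (𝔮 : QLetterY 𝔸 i) (𝔮s : QsLetterY 𝔸 i) (parS : SiteParY 𝔸 i) (Gp : SiteOpY 𝔸 i) (U₁ : B.Cfg)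
    (ζ : ↥(cubes i.D.toDomains) → SiteY i → ℝ) (hζ : ∀ c z, hTY i c z ≠ 0 → ζ c z = 1)
    (Gl : ↥(cubes i.D.toDomains) → BondOpY 𝔸 i) (Pl P1l E : ↥(cubes i.D.toDomains) → Module.End ℂ (FBondY i → 𝔸))
    (hP1 : ∀ c, Pl c * cutMulY (hBdY i (hTY i c)) = cutMulY (hBdY i (hTY i c)) * Pl c + P1l c)
    (hdefT : ∀ c, cutMulY (hBdY i (hTY i c)) * Gl c (cfg U₁) * (deltaLocQY i 𝔮 𝔮s (cfg U₁) - Pl c) * cutMulY (hBdY i (hTY i c)) =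
      cutMulY (hBdY i (hTY i c)) * cutMulY (hBdY i (hTY i c)) - E c) :
    (∑ c, mulOp (fun p : XBK κ i => hTY i c (chartY i p.1.src)) * GcoK i b B cfg (Gl c) U₁ * mulOp (fun p : XBK κ i => hTY i c (chartY i p.1.src))) *
        S0coKq i b B cfg 𝔮 𝔮s parS Gp U₁ =
      1 + ∑ c, coordAlgHomB i b (cutMulY (hBdY i (hTY i c)) * Gl c (cfg U₁) * KhBQY i (hTY i c) 𝔮 𝔮s (cfg U₁))
        + ∑ c, coordAlgHomB i b (cutMulY (hBdY i (hTY i c)) * Gl c (cfg U₁) * P1l c)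
        - ∑ c, coordAlgHomB i b (cutMulY (hBdY i (hTY i c)) * Gl c (cfg U₁) * cutMulY (hBdY i (hTY i c)) *
            (cutMulY (hBdY i (ζ c)) * (DPDsY i parS Gp (cfg U₁) - Pl c)))
        - ∑ c, coordAlgHomB i b (cutMulY (hBdY i (hTY i c)) * Gl c (cfg U₁) * cutMulY (hBdY i (hTY i c)) *
            ((1 - cutMulY (hBdY i (ζ c))) * DPDsY i parS Gp (cfg U₁)))
        - ∑ c, coordAlgHomB i b (E c) := by
  have eM : ∀ c : ↥(cubes i.D.toDomains),
      mulOp (fun p : XBK κ i => hTY i c (chartY i p.1.src)) = coordAlgHomB i b (cutMulY (𝔸 := 𝔸) (hBdY i (hTY i c))) :=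
    fun c => mulOp_bond_eq_coordOpK i b (hTY i c)
  simp only [eM, S0coKq_eq_smul_coordAlgHomB, GcoK_eq_smul_coordAlgHomB]
  rw [sum_smul_mul_smul_eq i b hc, eq3105QT_hT_defect i 𝔮 𝔮s parS Gp (cfg U₁) ζ hζ (fun c => Gl c (cfg U₁)) Pl P1l E hP1 hdefT]
  simp only [map_sub, map_add, map_sum, map_one]

end CoordsB

end Literature.MathematicalPhysics.QuantumFieldTheory.Balaban1983to89.B9Eq3105OfLocalInverseQ

end
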